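import Literature.AlgebraicGeometry.Resolution.AffineCoordinateBlowupCharts
import Literature.AlgebraicGeometry.Resolution.AffinePointBlowupLocal
import HarnessLib

/-!
# A blow-up of a closed subset WITH AN AFFINE CHART CARRYING IT TO A COORDINATE SUBSPACE is, over the chart, a blow-up of
# `𝔸ⁿ⁺¹_K` along `C_Λ` — hence SMOOTH over `K` (every `n`, every `Λ`, every field `K`)

Topic: `Literature/AlgebraicGeometry/Resolution`. Scheme-level sequel of `AffineCoordinateBlowupCharts.lean` and the every-codimension
form of `AffinePointBlowupLocal.lean` (there: a closed POINT with an affine chart). Setting: a scheme `Z` over `Spec K`, a closed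
subset `D ⊆ Z`, an open `V ⊆ Z` CONTAINING `D` with an isomorphism `e : V ≅ 𝔸ⁿ⁺¹_K = AffinePointBlowup.P n K` carrying `D` onto the
coordinate subspace `C_Λ = V(xᵢ : i ∈ Λ)` (`hDe : (D ∩ V).preimage e⁻¹ = C_Λ` as closed subsets of `𝔸ⁿ⁺¹`), and ANY blowing up
`π : W → Z` of the reduced ideal `𝓘_D` (`IsBlowup`, universal property):

* `comap_comap_vanishingIdeal_eq_𝓘Λ` — `e_* (𝓘_D|_V) = 𝓘_Λ` (reduced ideals pull back along open immersions and isomorphisms);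
* `isBlowup_restrict_comp_affineChartΛ` — **`(π|_V) ≫ e` is a blowing up of `𝔸ⁿ⁺¹_K` along `𝓘_Λ`**;
* `preimage_sup_preimage_compl_eq_top` — `W = π⁻¹(V) ∪ π⁻¹(Z ∖ D)` (for `D ⊆ V`);
* **`smooth_comp_of_affineChartΛ` — for `Z → Spec K` smooth and the chart over `K`, `W → Spec K` is SMOOTH** (over the chart it is the
  blown-up affine space `AffineCoordBlowup.smooth_comp`; off `D` it is an isomorphism onto an open of `Z`), every field `K`;
* `vanishingIdeal_ne_bot_of_affineChartΛ` — `𝓘_D ≠ 0` (for `Λ` nonempty).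

The consumer is the HIRONAKA-L lane's «honest later rounds» along plane / line centres inside a chart of an earlier blow-up
(`Hironaka2017/Lib/AffineCoordBlowupLSBChart.lean`). No named facts.

## Sources
* U. Görtz, T. Wedhorn, *Algebraic Geometry I*, 2nd ed. (2020), Prop. 13.91 (blow-ups and flat base change; restriction to opens),
  (13.19) p. 413. [GortzWedhorn2020]
* The Stacks Project, Tags 0804, 02OS, 01HR. [StacksProject]
* A. Grothendieck, EGA IV₄ (1967), Prop. 17.5.8 (iii) (smoothness is local on the source). [Grothendieck1967]
-/

noncomputable section

open CategoryTheory AlgebraicGeometry TopologicalSpace Opposite MvPolynomial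
open Scheme.IdealSheafData

namespace Literature.AlgebraicGeometry.Resolution

namespace AffineCoordBlowup

open AffinePointBlowup

universe u

variable {n : ℕ} {K : Type u} [Field K] {Λ : Set (Fin (n + 1))}

section Chart

variable {Z : Scheme.{u}} {f : Z ⟶ Spec (.of K)} {D : Closeds Z} {V : Z.Opens} {W : Scheme.{u}} {π : W ⟶ Z}

/-- **Moving `𝓘_D` to the chart**: if `e : V ≅ 𝔸ⁿ⁺¹_K` carries `D ∩ V` onto `C_Λ`, then `e_* (𝓘_D|_V) = 𝓘_Λ`.
[cite: GortzWedhorn2020, Prop. 13.91] -/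
theorem comap_comap_vanishingIdeal_eq_𝓘Λ (e : (V : Scheme.{u}) ≅ P n K)
    (hDe : (D.preimage V.ι.continuous).preimage e.inv.base.hom.continuous = CΛ n K Λ) :
    ((vanishingIdeal D).comap V.ι).comap e.inv = 𝓘Λ n K Λ := by
  rw [comap_vanishingIdeal_of_isOpenImmersion V.ι]
  have h := vanishingIdeal_comap_hom e.symm (D.preimage V.ι.continuous)
  rw [Iso.symm_hom] at h
  rw [h, 𝓘Λ, hDe]

/-- **Over the chart the blow-up of `D` is a blow-up of `𝔸ⁿ⁺¹_K` along `C_Λ`**: `(π|_V) ≫ e` is a blowing up of `P n K` along `𝓘_Λ`.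
[cite: GortzWedhorn2020, Prop. 13.91] -/
theorem isBlowup_restrict_comp_affineChartΛ (e : (V : Scheme.{u}) ≅ P n K)
    (hDe : (D.preimage V.ι.continuous).preimage e.inv.base.hom.continuous = CΛ n K Λ)
    (hπ : IsBlowup π (vanishingIdeal D)) : IsBlowup ((π ∣_ V) ≫ e.hom) (𝓘Λ n K Λ) := by
  have h := (hπ.restrict V).comp_iso e
  rwa [comap_comap_vanishingIdeal_eq_𝓘Λ e hDe] at h

omit [Field K] in
/-- The two opens `π⁻¹(V)` and `π⁻¹(Z ∖ D)` cover `W` when `D ⊆ V`. [cite: StacksProject, Tag 02OS] -/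
theorem preimage_sup_preimage_compl_eq_top (hDV : (D : Set Z) ⊆ V) :
    π ⁻¹ᵁ V ⊔ π ⁻¹ᵁ ⟨((vanishingIdeal D).support : Set Z)ᶜ, (vanishingIdeal D).support.isClosed.isOpen_compl⟩ = ⊤ := by
  apply le_antisymm le_top
  intro x _
  by_cases hx : π.base x ∈ (D : Set Z)
  · left
    exact hDV hx
  · right
    show π.base x ∈ ((vanishingIdeal D).support : Set Z)ᶜ
    rw [Scheme.IdealSheafData.coe_support_vanishingIdeal]
    exact hx

/-- **A blow-up of a closed subset with an affine chart onto a coordinate subspace is SMOOTH over `K`** — every field `K`: over the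
chart it is the blown-up affine space (`AffineCoordBlowup.smooth_comp`), off `D` it is an isomorphism onto an open of the smooth `Z`.
[cite: Grothendieck1967, Prop. 17.5.8 (iii) (PDF p. 69)] -/
theorem smooth_comp_of_affineChartΛ [Smooth f] (hDV : (D : Set Z) ⊆ V) (e : (V : Scheme.{u}) ≅ P n K)
    (he : e.hom ≫ AffinePointBlowup.f n K = V.ι ≫ f)
    (hDe : (D.preimage V.ι.continuous).preimage e.inv.base.hom.continuous = CΛ n K Λ)
    (hπ : IsBlowup π (vanishingIdeal D)) : Smooth (π ≫ f) := by
  let Vc : Z.Opens := ⟨((vanishingIdeal D).support : Set Z)ᶜ, (vanishingIdeal D).support.isClosed.isOpen_compl⟩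
  refine IsZariskiLocalAtSource.of_iSup_eq_top (P := @Smooth) (fun b : Bool => bif b then π ⁻¹ᵁ V else π ⁻¹ᵁ Vc)
    ?_ fun b => ?_
  · rw [← preimage_sup_preimage_compl_eq_top hDV (π := π)]
    apply le_antisymm
    · refine iSup_le fun b => ?_
      cases b
      · exact le_sup_right
      · exact le_sup_left
    · exact sup_le (le_iSup (fun b : Bool => bif b then π ⁻¹ᵁ V else π ⁻¹ᵁ Vc) true)
        (le_iSup (fun b : Bool => bif b then π ⁻¹ᵁ V else π ⁻¹ᵁ Vc) false)
  · cases b with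
    | true =>
      -- over the chart: the blown-up affine space
      show Smooth ((π ⁻¹ᵁ V).ι ≫ π ≫ f)
      have hb := isBlowup_restrict_comp_affineChartΛ e hDe hπ
      haveI := AffineCoordBlowup.smooth_comp hb
      have heq : (π ⁻¹ᵁ V).ι ≫ π ≫ f = ((π ∣_ V) ≫ e.hom) ≫ AffinePointBlowup.f n K := by
        rw [Category.assoc, he, ← Category.assoc, ← morphismRestrict_ι, Category.assoc]
      rw [heq]
      infer_instance
    | false =>
      -- off the centre: an isomorphism onto an open of `Z`
      show Smooth ((π ⁻¹ᵁ Vc).ι ≫ π ≫ f)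
      haveI : IsIso (π ∣_ Vc) := hπ.isIso_compl
      have heq : (π ⁻¹ᵁ Vc).ι ≫ π ≫ f = (π ∣_ Vc) ≫ Vc.ι ≫ f := by
        rw [← Category.assoc, ← morphismRestrict_ι, Category.assoc]
      rw [heq]
      infer_instance

/-- **`𝓘_D ≠ 0`** for a closed subset with an affine chart onto `C_Λ`, `Λ` nonempty. [cite: StacksProject, Tag 01HR] -/
theorem vanishingIdeal_ne_bot_of_affineChartΛ (hΛ : Λ.Nonempty) (e : (V : Scheme.{u}) ≅ P n K)
    (hDe : (D.preimage V.ι.continuous).preimage e.inv.base.hom.continuous = CΛ n K Λ) :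
    vanishingIdeal D ≠ ⊥ := by
  intro h
  have h2 := comap_comap_vanishingIdeal_eq_𝓘Λ e hDe
  rw [h, Scheme.IdealSheafData.comap_bot, Scheme.IdealSheafData.comap_bot] at h2
  exact 𝓘Λ_ne_bot n K Λ hΛ h2.symm

/-- A blow-up of such a `D` is locally of finite type over `K` (for `Z → Spec K` smooth). [cite: StacksProject, Tag 02NS] -/
theorem locallyOfFiniteType_comp_of_affineChartΛ [Smooth f] (hDV : (D : Set Z) ⊆ V) (e : (V : Scheme.{u}) ≅ P n K)
    (he : e.hom ≫ AffinePointBlowup.f n K = V.ι ≫ f)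
    (hDe : (D.preimage V.ι.continuous).preimage e.inv.base.hom.continuous = CΛ n K Λ)
    (hπ : IsBlowup π (vanishingIdeal D)) : LocallyOfFiniteType (π ≫ f) := by
  haveI := smooth_comp_of_affineChartΛ hDV e he hDe hπ
  infer_instance

end Chart

end AffineCoordBlowup

end Literature.AlgebraicGeometry.Resolution

end
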